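import Mathlib
import HarnessLib
import Summits.HubbardSuperconductivity.HubbardSuperconductivity.Theorems.KLProgrammeKLRegimeTwoVolumeTowerBaseGridInput
import Summits.HubbardSuperconductivity.HubbardSuperconductivity.Theorems.KLProgrammeKLRegimeTwoVolumeTopFrameGridDataAt
import Summits.HubbardSuperconductivity.HubbardSuperconductivity.Theorems.KLProgrammeKLRegimeTwoVolumeTowerBaseDefs
import Literature.MathematicalPhysics.QuantumLattice.GrassmannFlowIteration

/-!
# Route `KLProgramme` — crux K3, VL child `KLRegimeVolumeLimitV17F2` (stmt-HubbardSuperconductivity-20440), blueprint v5 M5 / W4 base data: THE WEIGHTED PROFILE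
# OF THE UV-STEPPED GRID ACTION `klGridAction V M β U μ K` FROM k3c4-p2's GRID DATA (conjuncts 6–7 of the base-transfer bundle `hdataT` of `…TowerBase` /
# `towerDataT_of_partsD`; seat hubbard-kl-k3c4-p1 g14; `--supports` 20440)

`hdataT` asks, for both volumes, the `(1 + labelDiam(Λg·tnorm))`-weighted pinned profile of `klGridAction V M β U μ K = effAction (S_Nᵀ C^K_{>Λ_1} S_N) (V_N + 𝒩_K)`
in EVERY degree `k` with a budget `ε_M · NG k`, `NG` volume-free.  k3c4-p2's `…TopFrameGridDataAt.frame_gridDataAt` (p590099) gives, at `Λ = Λ_1`, the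
`(1 + labelDiam(tnorm))`-weighted EVEN profile `≤ ρ⁻¹^{2m′}·e·normV(κ₀, ρ, Nv_K)/(1 − θ)` from the `gridLabelWt`-weighted rows/columns `≤ αw` of the grid
covariance and the smallness `θ = e·αw·normV(κ₀,ρ,Nv_K)/κ₀² < 1` (`κ₀ = √(2(7+6593))`); the odd kernels vanish (the grid action is even:
`effAction_mem_evenPart` on the even, constant-free grid input); and `…TowerBaseGridInput.towerGrid_normV_inputBudget_le` bounds `normV(κ₀,ρ,Nv_K) ≤ ε_M·Θ`
with `Θ = ((e²(κ₀+ρ))²F + (e²(κ₀+ρ))⁴|U|)/2` volume-free once the frame kernel's first moment is `≤ F`.  In the grid scaling (`αw ∝ 1/ε_M`) the smallness is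
the volume-free `θ̄ ≥ e·αw·ε_M·Θ/κ₀²`, `θ̄ < 1`.  Hence:

* `klGridAction_mem_evenPart` — the grid action is even;
* **`klGridAction_wtProfile_le`** — `∀ k p y, Σ_{Y : Y p = y} ‖kernel (klGridAction V M β U μ K) k Y‖·(1 + labelDiam(1·tnorm)) ≤ ε_M · NG k` with the
  volume-free budget `NG k := [Even k]·ρ⁻¹^k·e·Θ/(1 − θ̄)` (weight rate `Λg = 1`).

Proofs only; no definition. [cite: BenfattoGiulianiMastropietro2006, §2.1 (2.5), §2.5 (2.52)–(2.55)]
-/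

noncomputable section

namespace Summit.HubbardSuperconductivity.HubbardSuperconductivity.Theorems.TwoVolumeSource

set_option linter.dupNamespace false -- summit = problem name (single-conjunct summit), D-0017

open Finset Literature.MathematicalPhysics.QuantumLattice GrassmannAlgebra Literature.Probability.LatticeModels
  Literature.Probability.LatticeModels.BattleFederbush
open Literature.MathematicalPhysics.QuantumLattice.FermiRG
open Summit.HubbardSuperconductivity.HubbardSuperconductivity.Theorems.KLProgrammeLegKernels
open Summit.HubbardSuperconductivity.HubbardSuperconductivity.Theorems.KLRegimeSplit
open Summit.HubbardSuperconductivity.HubbardSuperconductivity.Theorems.EngineV8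
open Summit.HubbardSuperconductivity.HubbardSuperconductivity.Theorems.TwoVolumeDefect

/-- **The UV-stepped grid action is even.** [folklore] -/
theorem klGridAction_mem_evenPart {V M : ℕ} [NeZero V] (β U μ : ℝ) (K : TrigPolyC4v) :
    klGridAction V M β U μ K ∈ evenPart ℂ (GridLeg (GridPoint V (klGridN M))) := by
  unfold klGridAction
  refine effAction_mem_evenPart _ (add_mem (hubbardGridInteraction_mem_evenPart β U) (hubbardGridCounterQuadratic_mem_evenPart β K)) ?_
  rw [map_add, constPart_hubbardGridInteraction, constPart_hubbardGridCounterQuadratic, add_zero]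

/-- **THE WEIGHTED PROFILE OF THE UV-STEPPED GRID ACTION FROM THE GRID DATA** (see the module docstring): conjuncts 6–7 of the base-transfer bundle at one
volume, weight rate `Λg = 1`, volume-free budget `NG k := [Even k]·ρ⁻¹^k·e·Θ/(1 − θ̄)`. [cite: BenfattoGiulianiMastropietro2006, §2.5 (2.52)–(2.55)] -/
theorem klGridAction_wtProfile_le {V M : ℕ} [NeZero V] [NeZero M] {R : RenConsts} {U μ β : ℝ} {Nsc : ℕ} {K : TrigPolyC4v}
    (hK : FrameOK R U Nsc μ K) (hβ : klBetaMin ≤ β) (hβV : β ≤ V) {αw : ℝ} (hαw : 0 < αw)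
    (hrow : ∀ X, ∑ Y, ‖((hubbardGridSub V M β (2 * (2 * M))).transpose * hubbardCovAboveCT V M β μ 0 K (klScale klE0 1) *
        hubbardGridSub V M β (2 * (2 * M))) X Y‖ * gridLabelWt V (2 * (2 * M)) β {gridLegPos X, gridLegPos Y} ≤ αw)
    (hcol : ∀ Y, ∑ X, ‖((hubbardGridSub V M β (2 * (2 * M))).transpose * hubbardCovAboveCT V M β μ 0 K (klScale klE0 1) *
        hubbardGridSub V M β (2 * (2 * M))) X Y‖ * gridLabelWt V (2 * (2 * M)) β {gridLegPos X, gridLegPos Y} ≤ αw)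
    {ρ F Θ θb : ℝ} (hρ : 0 < ρ) (hF : ∑ z : TorusSite 2 V, ‖framePosKernel V K z‖ * (1 + torusSiteDist z 0) ≤ F)
    (hΘ : ((Real.exp 2 * (Real.sqrt (2 * (7 + 6593)) + ρ)) ^ 2 * F + (Real.exp 2 * (Real.sqrt (2 * (7 + 6593)) + ρ)) ^ 4 * |U|) / 2 ≤ Θ)
    (hθb : Real.exp 1 * αw * (imagTimeWeight β M * Θ) / Real.sqrt (2 * (7 + 6593)) ^ 2 ≤ θb) (hθb1 : θb < 1) :
    ∀ (k : ℕ) (p : Fin k) (y : GridLeg (GridPoint V (klGridN M))),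
      ∑ Y ∈ univ.filter (fun Y : Fin k → GridLeg (GridPoint V (klGridN M)) => Y p = y),
          ‖kernel ℂ (klGridAction V M β U μ K) k Y‖ *
            (1 + labelDiam (fun Y₁ Y₂ : GridLeg (GridPoint V (klGridN M)) => (1 : ℝ) * (Torus.tnorm (Y₁.1.1.2 - Y₂.1.1.2) : ℝ)) (univ.image Y)) ≤
        imagTimeWeight β M * (if Even k then ρ⁻¹ ^ k * (Real.exp 1 * Θ / (1 - θb)) else 0) := by
  classical
  intro k p y
  have hβ0 : 0 < β := pos_of_klBetaMin_le hβ
  have hε : 0 ≤ imagTimeWeight β M := imagTimeWeight_nonneg hβ0.le M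
  set κ₀ : ℝ := Real.sqrt (2 * (7 + 6593)) with hκ₀
  have hκ₀0 : 0 ≤ κ₀ := Real.sqrt_nonneg _
  set Nv : ℕ → ℝ := fun m' : ℕ => if m' = 1 then |β| / (2 * (2 * M) : ℕ) * ∑ z : TorusSite 2 V, ‖framePosKernel V K z‖ * (1 + torusSiteDist z 0)
      else if m' = 2 then |U| * |β| / (2 * (2 * M) : ℕ) else 0 with hNv
  -- the field-weighted norm of the input budget is `≤ ε·Θ`
  have hX : normV (GridLeg (GridPoint V (klGridN M))) κ₀ ρ Nv ≤ imagTimeWeight β M * Θ :=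
    (towerGrid_normV_inputBudget_le (GridLeg (GridPoint V (klGridN M))) hβ0 U K hκ₀0 hρ.le hF).trans (mul_le_mul_of_nonneg_left hΘ hε)
  have hX0 : 0 ≤ normV (GridLeg (GridPoint V (klGridN M))) κ₀ ρ Nv := normV_nonneg hκ₀0 hρ.le fun m' => towerGrid_inputBudget_nonneg β U K m'
  -- the actual smallness is below the volume-free one
  have hθle : Real.exp 1 * αw * normV (GridLeg (GridPoint V (klGridN M))) κ₀ ρ Nv / κ₀ ^ 2 ≤ θb :=
    le_trans (by gcongr) hθb
  have hθ : Real.exp 1 * αw * normV (GridLeg (GridPoint V (klGridN M))) κ₀ ρ Nv / κ₀ ^ 2 < 1 := hθle.trans_lt hθb1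
  -- k3c4-p2's grid data at `Λ = Λ_1`
  have hΛe : klScale klE0 1 ≤ klE0 := by unfold klScale klE0; norm_num
  obtain ⟨-, -, hprof⟩ := frame_gridDataAt (L := V) (M := M) hK hβ hβV le_rfl hΛe hαw hrow hcol hρ hθ
  have hF0 : 0 ≤ F := le_trans (sum_nonneg fun z _ => by have : 0 ≤ torusSiteDist z 0 := Nat.cast_nonneg _; positivity) hF
  have hΘ0 : 0 ≤ Θ :=
    le_trans (div_nonneg (add_nonneg (mul_nonneg (sq_nonneg _) hF0) (mul_nonneg (by positivity) (abs_nonneg U))) (by norm_num)) hΘ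
  -- the weight at rate `1`
  have hwt : ∀ Y : Fin k → GridLeg (GridPoint V (klGridN M)),
      (1 + labelDiam (fun Y₁ Y₂ : GridLeg (GridPoint V (klGridN M)) => (1 : ℝ) * (Torus.tnorm (Y₁.1.1.2 - Y₂.1.1.2) : ℝ)) (univ.image Y)) =
        1 + labelDiam (fun Y₁ Y₂ : GridLeg (GridPoint V (klGridN M)) => (Torus.tnorm (Y₁.1.1.2 - Y₂.1.1.2) : ℝ)) (univ.image Y) := fun Y => by
    simp only [one_mul]
  simp_rw [hwt]
  rcases Nat.even_or_odd k with ⟨m', rfl⟩ | hodd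
  · -- even degree `k = m' + m' = 2 m'`
    rw [if_pos ⟨m', rfl⟩]
    have hk : m' + m' = 2 * m' := by ring
    -- transport along `m' + m' = 2 m'`
    have hgoal : ∑ Y ∈ univ.filter (fun Y : Fin (m' + m') → GridLeg (GridPoint V (klGridN M)) => Y p = y),
        ‖kernel ℂ (klGridAction V M β U μ K) (m' + m') Y‖ *
          (1 + labelDiam (fun Y₁ Y₂ : GridLeg (GridPoint V (klGridN M)) => (Torus.tnorm (Y₁.1.1.2 - Y₂.1.1.2) : ℝ)) (univ.image Y)) ≤
        ρ⁻¹ ^ (2 * m') * (Real.exp 1 * normV (GridLeg (GridPoint V (klGridN M))) κ₀ ρ Nv) /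
          (1 - Real.exp 1 * αw * normV (GridLeg (GridPoint V (klGridN M))) κ₀ ρ Nv / κ₀ ^ 2) := by
      unfold klGridAction klGridN
      revert p
      rw [hk]
      intro p
      exact hprof m' p y
    refine hgoal.trans ?_
    rw [hk]
    -- monotonicity in `normV ≤ ε Θ` and `θ ≤ θb`
    have hden : 0 < 1 - θb := sub_pos.2 hθb1
    have h1 : Real.exp 1 * normV (GridLeg (GridPoint V (klGridN M))) κ₀ ρ Nv /
        (1 - Real.exp 1 * αw * normV (GridLeg (GridPoint V (klGridN M))) κ₀ ρ Nv / κ₀ ^ 2) ≤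
        Real.exp 1 * (imagTimeWeight β M * Θ) / (1 - θb) :=
      div_le_div₀ (mul_nonneg (Real.exp_pos 1).le (mul_nonneg hε hΘ0)) (mul_le_mul_of_nonneg_left hX (Real.exp_pos 1).le) hden
        (by linarith)
    calc ρ⁻¹ ^ (2 * m') * (Real.exp 1 * normV (GridLeg (GridPoint V (klGridN M))) κ₀ ρ Nv) /
          (1 - Real.exp 1 * αw * normV (GridLeg (GridPoint V (klGridN M))) κ₀ ρ Nv / κ₀ ^ 2)
        = ρ⁻¹ ^ (2 * m') * (Real.exp 1 * normV (GridLeg (GridPoint V (klGridN M))) κ₀ ρ Nv /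
          (1 - Real.exp 1 * αw * normV (GridLeg (GridPoint V (klGridN M))) κ₀ ρ Nv / κ₀ ^ 2)) := mul_div_assoc _ _ _
      _ ≤ ρ⁻¹ ^ (2 * m') * (Real.exp 1 * (imagTimeWeight β M * Θ) / (1 - θb)) := mul_le_mul_of_nonneg_left h1 (by positivity)
      _ = imagTimeWeight β M * (ρ⁻¹ ^ (2 * m') * (Real.exp 1 * Θ / (1 - θb))) := by ring
  · -- odd degree: the kernels vanish
    rw [if_neg (Nat.not_even_iff_odd.2 hodd), mul_zero]
    refine le_of_eq (sum_eq_zero fun Y _ => ?_)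
    rw [kernel_eq_zero_of_mem_evenPart_of_odd ℂ (klGridAction_mem_evenPart β U μ K) hodd Y, norm_zero, zero_mul]

end Summit.HubbardSuperconductivity.HubbardSuperconductivity.Theorems.TwoVolumeSource

end
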